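import Literature.AlgebraicGeometry.RelativeSpec.FiniteGroupQuotient
import Literature.RingTheory.GaloisAlgebras.ChaseHarrisonRosenbergTorsor
import Mathlib.AlgebraicGeometry.Morphisms.Finite
import Mathlib.AlgebraicGeometry.Morphisms.Flat
import Mathlib.AlgebraicGeometry.Morphisms.Proper
import Mathlib.AlgebraicGeometry.Noetherian
import HarnessLib

/-!
# Quotients by free actions of finite groups: `X → X/G` is finite, flat, surjective, a torsor

Continuation of `Literature.AlgebraicGeometry.RelativeSpec.FiniteGroupQuotient`. Let `r : X ⟶ Y`
be an affine morphism and `ρ : ActionOver r G` an action of a finite group `G` on `X` over `Y`,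
with quotient `π = ρ.toQuotient : X ⟶ X/G` and `X/G ⟶ Y` (`ρ.quotientToBase`). If the action is
**free** in the scheme-theoretic sense — on every `Γ(X, r⁻¹U)`, `U ⊆ Y` affine open, and for
every `g ≠ 1`, the `g • b - b` generate the unit ideal — then by the theorem of
Chase–Harrison–Rosenberg (`Literature.RingTheory.GaloisAlgebras`, Greither LNM 1534, Ch. 0,
Thm. 1.6) applied chart by chart:

* `isFinite_toQuotient`, `flat_toQuotient`, `surjective_toQuotient`: `π` is finite, flat (so finite
  locally free) and surjective — in particular an fpqc covering;
* `exists_eq_comp_aut_of_comp_toQuotient_eq`: the fibres of `π` on `Ω`-valued points (`Ω` a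
  field) are `G`-orbits: `x₁ ≫ π = x₂ ≫ π → ∃ g, x₂ = x₁ ≫ g`.

Independently of freeness, `isFinite_quotientToBase`: `X/G ⟶ Y` is finite when `r` is finite and
`Y` is locally noetherian (Mumford, *Abelian Varieties*, §7, Thm. p. 66: `Γ(π⁻¹U)^G` is a
finite module). The chart lemma `SubringDatum.toSpec_of_forall_specMap` reduces target-local
properties of `toSpec : X ⟶ Spec_Y(D.ring)` to the maps `Spec Γ(X, f⁻¹U) → Spec (D.ring U)`
(cf. Mathlib, `IsIso toNormalization`, Stacks 03GP), and `SubringDatum.isFinite_fromSpec` does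
the same for `Spec_Y(D.ring) ⟶ Y`.

These are the statements "(`X/G`, `π`) is a quotient, `π` is finite locally free and
`X ×_{X/G} X ≅ G × X` when `G` acts freely" of Mumford, *Abelian Varieties*, §7, Thm. p. 66 and
§12 (there for varieties over an algebraically closed field; SGA 3, Exp. V, Thm. 4.1 in general),
in the form needed for the quotient of an abelian variety by a finite subgroup.

## References

* [MumfordAV1970] D. Mumford, *Abelian Varieties* (1970), §7, Thm. p. 66; §12.
* [Greither1992CyclicGalois] C. Greither, LNM 1534, Ch. 0, Thm. 1.6, Lemma 1.9.
* SGA 3, Exp. V, Thm. 4.1. Mathlib `Mathlib.AlgebraicGeometry.Normalization` (chart arguments).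
-/

noncomputable section

universe u

open CategoryTheory Limits AlgebraicGeometry

namespace Literature.AlgebraicGeometry.RelativeSpec

namespace SubringDatum

variable {X Y : Scheme.{u}} {f : X ⟶ Y} (D : SubringDatum f) [IsAffineHom f]

set_option backward.defeqAttrib.useBackward true in
set_option backward.isDefEq.respectTransparency false in
/-- **Checking a property of `toSpec` on the affine charts.** A Zariski-local (on the target)
property of morphisms that respects isomorphisms holds for `toSpec : X ⟶ Spec_Y(D.ring)` as soon
as it holds for the maps of affine schemes `Spec Γ(X, f⁻¹U) → Spec (D.ring U)`, `U ⊆ Y` affine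
open (`f` affine): over the chart `Spec (D.ring U)` of `Spec_Y(D.ring)`, `toSpec` *is* that map
(cf. Mathlib, `IsIso toNormalization` for `f` integral, Stacks 03GP). [folklore] -/
theorem toSpec_of_forall_specMap (P : MorphismProperty Scheme.{u}) [IsZariskiLocalAtTarget P]
    (h : ∀ U : Y.affineOpens, P (Spec.map (CommRingCat.ofHom (D.ring U.1).subtype))) :
    P D.toSpec := by
  refine (IsZariskiLocalAtTarget.iff_of_openCover (P := P) D.openCover).mpr fun U ↦ ?_
  let e := IsOpenImmersion.isoOfRangeEq (pullback.fst D.toSpec (D.openCover.f U))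
    (f ⁻¹ᵁ U.1).ι (by simp [← Scheme.Hom.coe_opensRange, Scheme.Hom.opensRange_pullbackFst,
      ← D.fromSpec_preimage, ← Scheme.Hom.comp_preimage])
  rw [← MorphismProperty.cancel_left_of_respectsIso P (e ≪≫ (U.2.preimage f).isoSpec).inv]
  convert_to! P (Spec.map (CommRingCat.ofHom (D.ring U.1).subtype))
  · rw [← cancel_mono (D.openCover.f U), ← cancel_epi (U.2.preimage f).isoSpec.hom]
    simp [e, -Iso.cancel_iso_hom_left, IsAffineOpen.isoSpec_hom, toSpec]
    exact D.ι_lift f D.inclusion U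
  exact h U

set_option backward.isDefEq.respectTransparency false in
omit [IsAffineHom f] in
/-- **`fromSpec : Spec_Y(D.ring) ⟶ Y` is finite** when the `D.ring U` are finite
`Γ(Y, U)`-modules for `U` affine (over the chart `U`, `fromSpec` is `Spec (D.ring U) → U`;
cf. Mathlib `IsIntegralHom fromNormalization`). [folklore] -/
theorem isFinite_fromSpec [QuasiCompact f] [QuasiSeparated f]
    (h : ∀ U : Y.affineOpens, (D.diagramMap.app (.op U.1)).hom.Finite) :
    IsFinite D.fromSpec := by
  rw [IsZariskiLocalAtTarget.iff_of_iSup_eq_top (P := @IsFinite) _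
    (iSup_affineOpens_eq_top _)]
  intro U
  let e := IsOpenImmersion.isoOfRangeEq (D.fromSpec ⁻¹ᵁ U).ι (D.openCover.f U)
      (by simpa using congr($(D.fromSpec_preimage U).1))
  rw [← MorphismProperty.cancel_left_of_respectsIso @IsFinite e.inv,
    ← MorphismProperty.cancel_right_of_respectsIso @IsFinite _ U.2.isoSpec.hom]
  have : IsFinite (Spec.map (D.diagramMap.app (.op U))) := (IsFinite.SpecMap_iff _).mpr (h U)
  convert! this
  rw [← cancel_mono U.2.fromSpec]
  simp [IsAffineOpen.isoSpec_hom, e, ι_fromSpec]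

end SubringDatum

namespace ActionOver

variable {X Y : Scheme.{u}} {r : X ⟶ Y} {G : Type*} [Group G] (ρ : ActionOver r G)

/-! ### Complements on the action on sections -/

/-- The action on the restriction of a global section is the restriction of the pulled-back
global section: `act g (z|_{r⁻¹U}) = ((g⁻¹)♯ z)|_{r⁻¹U}`. [folklore] -/
theorem act_map_le_top (g : G) (U : Y.Opens) (z : Γ(X, ⊤)) :
    ρ.act g U (X.presheaf.map (homOfLE (le_top (a := r ⁻¹ᵁ U))).op z) =
      X.presheaf.map (homOfLE (le_top (a := r ⁻¹ᵁ U))).op ((ρ.aut g⁻¹).hom.appTop z) := by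
  rw [act_apply, ← CommRingCat.comp_apply, Scheme.Hom.map_appLE]
  rfl

/-- **`Spec` of the action on `Γ(X, r⁻¹U)`** for `r⁻¹U` affine: under `r⁻¹U ≅ Spec Γ(X, r⁻¹U)`
it is the restriction of the automorphism `g⁻¹` of `X` to `r⁻¹U` (Mathlib
`Scheme.Opens.toSpecΓ_SpecMap_appLE`). [folklore] -/
theorem specMap_act (g : G) (U : Y.Opens) (hV : IsAffineOpen (r ⁻¹ᵁ U)) :
    Spec.map (CommRingCat.ofHom (ρ.act g U)) =
      hV.isoSpec.inv ≫ (ρ.aut g⁻¹).hom.resLE (r ⁻¹ᵁ U) (r ⁻¹ᵁ U)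
        (ρ.preimage_preimage g⁻¹ U).ge ≫ hV.isoSpec.hom := by
  rw [← cancel_epi hV.isoSpec.hom, Iso.hom_inv_id_assoc]
  exact Scheme.Opens.toSpecΓ_SpecMap_appLE _ _ _ _

/-- `Spec` of the action, followed by `Spec Γ(X, r⁻¹U) ≅ r⁻¹U ↪ X`, is `r⁻¹U ↪ X` followed
by `g⁻¹`. [folklore] -/
@[reassoc]
theorem specMap_act_comp_ι (g : G) (U : Y.Opens) (hV : IsAffineOpen (r ⁻¹ᵁ U)) :
    Spec.map (CommRingCat.ofHom (ρ.act g U)) ≫ hV.isoSpec.inv ≫ (r ⁻¹ᵁ U).ι =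
      hV.isoSpec.inv ≫ (r ⁻¹ᵁ U).ι ≫ (ρ.aut g⁻¹).hom :=
  calc Spec.map (CommRingCat.ofHom (ρ.act g U)) ≫ hV.isoSpec.inv ≫ (r ⁻¹ᵁ U).ι
      = (hV.isoSpec.inv ≫ (ρ.aut g⁻¹).hom.resLE _ _ (ρ.preimage_preimage g⁻¹ U).ge ≫
          hV.isoSpec.hom) ≫ hV.isoSpec.inv ≫ (r ⁻¹ᵁ U).ι := by rw [ρ.specMap_act g U hV]
    _ = hV.isoSpec.inv ≫ (ρ.aut g⁻¹).hom.resLE _ _ (ρ.preimage_preimage g⁻¹ U).ge ≫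
          (r ⁻¹ᵁ U).ι := by simp only [Category.assoc, Iso.hom_inv_id_assoc]
    _ = hV.isoSpec.inv ≫ (r ⁻¹ᵁ U).ι ≫ (ρ.aut g⁻¹).hom := by rw [Scheme.Hom.resLE_comp_ι]

/-! ### The algebra of sections over an affine, as an extension of its invariants -/

section Algebra

variable (U : Y.Opens)

/-- `Γ(X, r⁻¹U)^G ⊆ Γ(X, r⁻¹U)` has the invariance property of Mathlib's `Algebra.IsInvariant`
(tautologically). [folklore] -/
theorem isInvariant_invariantsRing :
    letI := ρ.mulSemiringAction U
    Algebra.IsInvariant (ρ.invariantsRing U) Γ(X, r ⁻¹ᵁ U) G :=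
  letI := ρ.mulSemiringAction U
  ⟨fun b hb ↦ ⟨⟨b, hb⟩, rfl⟩⟩

/-- The inclusion `Γ(X, r⁻¹U)^G ⊆ Γ(X, r⁻¹U)` is injective (`FaithfulSMul`). [folklore] -/
theorem faithfulSMul_invariantsRing : FaithfulSMul (ρ.invariantsRing U) Γ(X, r ⁻¹ᵁ U) :=
  (faithfulSMul_iff_algebraMap_injective _ _).mpr Subtype.val_injective

variable [Finite G]
  (hfree : ∀ g : G, g ≠ 1 → Ideal.span (Set.range fun b : Γ(X, r ⁻¹ᵁ U) ↦ ρ.act g U b - b) = ⊤)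
include hfree

/-- **Free action ⇒ `Γ(X, r⁻¹U)` is finite over its invariants** (Chase–Harrison–Rosenberg,
`Literature.RingTheory.GaloisAlgebras.finite_of_free`). [cite: Greither1992CyclicGalois, Ch. 0 Thm. 1.6 (iii) (pp. 3–4)] -/
theorem finite_subtype_of_free : (ρ.invariantsRing U).subtype.Finite := by
  letI := ρ.mulSemiringAction U
  let _ : Fintype G := Fintype.ofFinite G
  haveI := ρ.isInvariant_invariantsRing U
  haveI := ρ.faithfulSMul_invariantsRing U
  have h : Module.Finite (ρ.invariantsRing U) Γ(X, r ⁻¹ᵁ U) :=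
    Literature.RingTheory.GaloisAlgebras.finite_of_free (ρ.invariantsRing U) G hfree
  exact RingHom.finite_algebraMap.mpr h

/-- **Free action ⇒ `Γ(X, r⁻¹U)` is flat over its invariants** (Chase–Harrison–Rosenberg,
`Literature.RingTheory.GaloisAlgebras.flat_of_free`: it is even projective).
[cite: Greither1992CyclicGalois, Ch. 0 Thm. 1.6 (iii) and Lemma 1.9 (pp. 3–5)] -/
theorem flat_subtype_of_free : (ρ.invariantsRing U).subtype.Flat := by
  letI := ρ.mulSemiringAction U
  let _ : Fintype G := Fintype.ofFinite G
  haveI := ρ.isInvariant_invariantsRing U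
  haveI := ρ.faithfulSMul_invariantsRing U
  have h : Module.Flat (ρ.invariantsRing U) Γ(X, r ⁻¹ᵁ U) :=
    Literature.RingTheory.GaloisAlgebras.flat_of_free (ρ.invariantsRing U) G hfree
  exact RingHom.flat_algebraMap_iff.mpr h

end Algebra

/-! ### Free actions: the quotient map is finite, flat and surjective -/

section Free

variable [Finite G] [IsAffineHom r]
  (hfree : ∀ (U : Y.affineOpens) (g : G), g ≠ 1 →
    Ideal.span (Set.range fun b : Γ(X, r ⁻¹ᵁ U) ↦ ρ.act g U b - b) = ⊤)
include hfree

/-- **For a free action, `π : X ⟶ X/G` is finite** (Mumford, *Abelian Varieties*, §7, Thm.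
p. 66 and §12; SGA 3, V.4.1: `X → X/G` is finite locally free when `G` acts freely; here from
Chase–Harrison–Rosenberg on each affine chart). [cite: MumfordAV1970, §7 Thm. p. 66 and §12] -/
theorem isFinite_toQuotient : IsFinite ρ.toQuotient :=
  ρ.invariants.toSpec_of_forall_specMap @IsFinite fun U ↦
    (IsFinite.SpecMap_iff _).mpr (ρ.finite_subtype_of_free U.1 (hfree U))

/-- **For a free action, `π : X ⟶ X/G` is flat** (hence finite locally free; SGA 3, V.4.1;
Mumford §12; from Chase–Harrison–Rosenberg on each affine chart).
[cite: MumfordAV1970, §7 Thm. p. 66 and §12] -/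
theorem flat_toQuotient : Flat ρ.toQuotient :=
  ρ.invariants.toSpec_of_forall_specMap @Flat fun U ↦
    (HasRingHomProperty.Spec_iff (P := @Flat)).mpr (ρ.flat_subtype_of_free U.1 (hfree U))

/-- **For a free action, `π : X ⟶ X/G` is surjective**: it is dominant (`isDominant_toSpec`)
and closed (finite). [cite: MumfordAV1970, §7 Thm. p. 66 and §12] -/
theorem surjective_toQuotient : Surjective ρ.toQuotient := by
  have : IsFinite ρ.toQuotient := ρ.isFinite_toQuotient hfree
  refine ⟨fun y ↦ ?_⟩
  have hclosed : IsClosed (Set.range ρ.toQuotient) :=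
    ρ.toQuotient.isClosedMap.isClosed_range
  have hdense : Dense (Set.range ρ.toQuotient) := ρ.toQuotient.denseRange
  have : Set.range ρ.toQuotient = Set.univ := by
    rw [← hclosed.closure_eq, hdense.closure_eq]
  exact (Set.range_eq_univ.mp this) y

end Free

/-! ### The quotient is finite over the base -/

/-- **`X/G ⟶ Y` is finite** when `r : X ⟶ Y` is finite and `Y` is locally noetherian: over an
affine `U`, `Γ(X, r⁻¹U)^G` is a submodule of the finite `Γ(Y, U)`-module `Γ(X, r⁻¹U)`
(Mumford, *Abelian Varieties*, §7, proof of the Thm. p. 66: "`Γ(π⁻¹U)^G` is a finite module").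
[cite: MumfordAV1970, §7 Thm. p. 66] -/
theorem isFinite_quotientToBase [Finite G] [IsFinite r] [IsLocallyNoetherian Y] :
    IsFinite ρ.quotientToBase := by
  refine ρ.invariants.isFinite_fromSpec fun U ↦ ?_
  -- `Γ(X, r⁻¹U)` is a finite module over the noetherian ring `Γ(Y, U)`
  letI := (r.app U.1).hom.toAlgebra
  haveI : Module.Finite Γ(Y, U.1) Γ(X, r ⁻¹ᵁ U.1) := IsFinite.finite_app r U.1 U.2
  haveI : IsNoetherianRing Γ(Y, U.1) := IsLocallyNoetherian.component_noetherian U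
  letI algA : Algebra Γ(Y, U.1) (ρ.invariantsRing U.1) :=
    (ρ.invariants.diagramMap.app (.op U.1)).hom.toAlgebra
  -- the inclusion of the invariants is `Γ(Y, U)`-linear and injective
  let l : ρ.invariantsRing U.1 →ₗ[Γ(Y, U.1)] Γ(X, r ⁻¹ᵁ U.1) :=
    { toFun := Subtype.val
      map_add' := fun _ _ ↦ rfl
      map_smul' := fun _ _ ↦ rfl }
  have : Module.Finite Γ(Y, U.1) (ρ.invariantsRing U.1) :=
    Module.Finite.of_injective l Subtype.val_injective
  exact this

end ActionOver

/-! ### Free actions: the fibres on field-valued points are `G`-orbits -/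

namespace ActionOver

variable {X Y : Scheme.{u}} {r : X ⟶ Y} {G : Type*} [Group G] (ρ : ActionOver r G)
variable [Finite G] [IsAffineHom r]

set_option backward.isDefEq.respectTransparency false in
/-- **The fibres of `π : X ⟶ X/G` on field-valued points are `G`-orbits** for a free action:
two `Ω`-valued points of `X` (`Ω` a field) with the same image in `X/G` differ by an element
of `G` (Mumford, *Abelian Varieties*, §7, Thm. p. 66 (1): "as a topological space, `Y = X/G` is
the quotient"; here in the scheme-theoretic form on `Ω`-points, from Chase–Harrison–Rosenberg,
`Literature.RingTheory.GaloisAlgebras.exists_smul_eq_of_algHom`, on an affine chart `r⁻¹U`).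
[cite: MumfordAV1970, §7 Thm. p. 66] -/
theorem exists_eq_comp_aut_of_comp_toQuotient_eq
    (hfree : ∀ (U : Y.affineOpens) (g : G), g ≠ 1 →
      Ideal.span (Set.range fun b : Γ(X, r ⁻¹ᵁ U) ↦ ρ.act g U b - b) = ⊤)
    {Ω : Type u} [Field Ω] (x₁ x₂ : Spec (.of Ω) ⟶ X)
    (h : x₁ ≫ ρ.toQuotient = x₂ ≫ ρ.toQuotient) :
    ∃ g : G, x₂ = x₁ ≫ (ρ.aut g).hom := by
  classical
  have hr : x₂ ≫ r = x₁ ≫ r := by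
    rw [← ρ.toQuotient_quotientToBase, ← Category.assoc, ← h, Category.assoc]
  -- an affine open `U ∋ r(x₁)`; both points factor through the affine open `V = r⁻¹U`
  let p₀ : ↥(Spec (.of Ω)) := default
  obtain ⟨U, hU⟩ : ∃ U : Y.affineOpens, (x₁ ≫ r) p₀ ∈ U.1 :=
    TopologicalSpace.Opens.mem_iSup.mp
      ((iSup_affineOpens_eq_top Y).ge (Set.mem_univ ((x₁ ≫ r) p₀)))
  have hV : IsAffineOpen (r ⁻¹ᵁ U.1) := U.2.preimage r
  have hrange : ∀ x : Spec (.of Ω) ⟶ X, x ≫ r = x₁ ≫ r →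
      Set.range x ⊆ Set.range (r ⁻¹ᵁ U.1).ι := by
    intro x hx
    rintro _ ⟨p, rfl⟩
    rw [Scheme.Opens.range_ι]
    obtain rfl : p = p₀ := Subsingleton.elim _ _
    change (x ≫ r) p₀ ∈ U.1
    rw [hx]
    exact hU
  obtain ⟨l₁, hl₁⟩ : ∃ l : Spec (.of Ω) ⟶ (r ⁻¹ᵁ U.1), l ≫ (r ⁻¹ᵁ U.1).ι = x₁ :=
    ⟨_, IsOpenImmersion.lift_fac (r ⁻¹ᵁ U.1).ι x₁ (hrange x₁ rfl)⟩
  obtain ⟨l₂, hl₂⟩ : ∃ l : Spec (.of Ω) ⟶ (r ⁻¹ᵁ U.1), l ≫ (r ⁻¹ᵁ U.1).ι = x₂ :=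
    ⟨_, IsOpenImmersion.lift_fac (r ⁻¹ᵁ U.1).ι x₂ (hrange x₂ hr)⟩
  -- as ring maps `φᵢ : Γ(X, r ⁻¹ᵁ U.1) → Ω`
  obtain ⟨φ₁, hφ₁⟩ : ∃ φ : Γ(X, r ⁻¹ᵁ U.1) ⟶ .of Ω, Spec.map φ = l₁ ≫ hV.isoSpec.hom :=
    ⟨_, Spec.map_preimage _⟩
  obtain ⟨φ₂, hφ₂⟩ : ∃ φ : Γ(X, r ⁻¹ᵁ U.1) ⟶ .of Ω, Spec.map φ = l₂ ≫ hV.isoSpec.hom :=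
    ⟨_, Spec.map_preimage _⟩
  have hx : ∀ {l : Spec (.of Ω) ⟶ (r ⁻¹ᵁ U.1)} {x : Spec (.of Ω) ⟶ X} {φ : Γ(X, r ⁻¹ᵁ U.1) ⟶ .of Ω},
      l ≫ (r ⁻¹ᵁ U.1).ι = x → Spec.map φ = l ≫ hV.isoSpec.hom → x = Spec.map φ ≫ hV.isoSpec.inv ≫ (r ⁻¹ᵁ U.1).ι := by
    rintro l x φ rfl hφ
    rw [hφ, Category.assoc, Iso.hom_inv_id_assoc]
  -- the two ring maps agree on the invariants
  let ι : CommRingCat.of (ρ.invariantsRing U.1) ⟶ Γ(X, r ⁻¹ᵁ U.1) :=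
    CommRingCat.ofHom (ρ.invariantsRing U.1).subtype
  have key : ∀ {l : Spec (.of Ω) ⟶ (r ⁻¹ᵁ U.1)} {x : Spec (.of Ω) ⟶ X}
      {φ : Γ(X, r ⁻¹ᵁ U.1) ⟶ .of Ω}, l ≫ (r ⁻¹ᵁ U.1).ι = x → Spec.map φ = l ≫ hV.isoSpec.hom →
      Spec.map (ι ≫ φ) ≫ ρ.invariants.openCover.f U = x ≫ ρ.toQuotient := by
    rintro l x φ rfl hφ
    have e := ρ.invariants.ι_lift r ρ.invariants.inclusion U
    calc Spec.map (ι ≫ φ) ≫ ρ.invariants.openCover.f U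
        = l ≫ hV.isoSpec.hom ≫ Spec.map ι ≫ ρ.invariants.openCover.f U := by
          rw [Spec.map_comp, Category.assoc, hφ, Category.assoc]
      _ = l ≫ (r ⁻¹ᵁ U.1).toSpecΓ ≫ Spec.map (ρ.invariants.inclusion.app (.op U.1)) ≫
            ρ.invariants.openCover.f U := by
          rw [hV.isoSpec_hom]
          rfl
      _ = l ≫ (r ⁻¹ᵁ U.1).ι ≫ ρ.invariants.lift r ρ.invariants.inclusion :=
          congrArg (l ≫ ·) e.symm
      _ = (l ≫ (r ⁻¹ᵁ U.1).ι) ≫ ρ.toQuotient := (Category.assoc _ _ _).symm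
  have hιφ : ι ≫ φ₁ = ι ≫ φ₂ := by
    apply Spec.map_injective
    rw [← cancel_mono (ρ.invariants.openCover.f U), key hl₁ hφ₁, key hl₂ hφ₂, h]
  -- Chase–Harrison–Rosenberg on the chart: `φ₂ = φ₁ ∘ g`
  letI := ρ.mulSemiringAction U.1
  let _ : Fintype G := Fintype.ofFinite G
  haveI := ρ.isInvariant_invariantsRing U.1
  haveI := ρ.faithfulSMul_invariantsRing U.1
  letI : Algebra (ρ.invariantsRing U.1) Ω := (ι ≫ φ₁).hom.toAlgebra
  let ψ₁ : Γ(X, r ⁻¹ᵁ U.1) →ₐ[ρ.invariantsRing U.1] Ω :=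
    { φ₁.hom with commutes' := fun _ ↦ rfl }
  let ψ₂ : Γ(X, r ⁻¹ᵁ U.1) →ₐ[ρ.invariantsRing U.1] Ω :=
    { φ₂.hom with commutes' := fun a ↦ (congr($(hιφ).hom a)).symm }
  obtain ⟨g, hg⟩ := Literature.RingTheory.GaloisAlgebras.exists_smul_eq_of_algHom
    (ρ.invariantsRing U.1) G (hfree U) ψ₁ ψ₂
  have hφ : φ₂ = CommRingCat.ofHom (ρ.act g U.1) ≫ φ₁ := by
    ext b
    exact hg b
  -- back to schemes: `Spec (act g) = g⁻¹` on `r⁻¹U`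
  refine ⟨g⁻¹, ?_⟩
  rw [hx hl₂ hφ₂, hx hl₁ hφ₁, hφ, Spec.map_comp, Category.assoc, ρ.specMap_act_comp_ι g U.1 hV]
  simp only [Category.assoc]

end ActionOver

end Literature.AlgebraicGeometry.RelativeSpec
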